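import Summits.QuantumFields.YangMills.Theorems.ColdStartUniversalityLatticeLangevinCocycle
import HarnessLib

/-!
# Route `ColdStartUniversality` (rung input (M), crux K_A1 stmt-QuantumFields-24809): the COCYCLE of the SU(2) lattice
# Langevin flow at dyadic times

Helper file (seat `ym-line-csu-p1`, g4).  `cocycle_dyadic`: on the canonical continuous-path space (law of any flat
Brownian motion, coordinate process) there is a solution family `U` of the Shen–Zhu–Zhu system from every start, jointly
measurable in (start, path), with the flow property at every DYADIC time `s = k₀/2^{m₀}`:
`U x (s + t) p = U (U x s p) t (θ_s p)` for a.e. path `p` (pathwise uniqueness applied to the spliced process of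
`isSolution_splice`).  This is the stochastic-flow input of `chapmanKolmogorov_of_cocycle` at dyadic times.  Then:

* `kernel_comp_of_cocycle_at` — pointwise-in-time form of `chapmanKolmogorov_of_cocycle`;
* `chapmanKolmogorov_dyadic`, `chapmanKolmogorov_szz` — CHAPMAN–KOLMOGOROV `κ (s+t) = κ t ∘ₖ κ s` for THE transition
  kernels of the SU(2) SZZ dynamics, first for dyadic `s`, then for all `s` (dyadic approximation from below; the laws
  `κ_u x = law(U x u)` are weakly continuous in `u` by path continuity, `y ↦ κ_t y` is Feller by
  `continuous_integral_transitionKernel`, and finite Borel measures on the Polish `SU(2)^E` are determined by bounded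
  continuous integrands) — the structural hypothesis (CK) of `…UniformColdStartMixingRungOfHarris` DISCHARGED;
* ★ `fixedCutoffMixing_of_doeblin` — the rung `stub_fixedCutoffMixing` of K_A1 follows from (D) a Doeblin minorisation
  of the transition kernels at one time and the named fact `WilsonMeasureLangevinInvariant` (SZZ Lemma 3.3) ALONE.

No definition, no sorry.  RECORD-rung R3 plumbing; nothing here bears on the Yang–Mills mass gap.
-/

set_option autoImplicit false

noncomputable section

namespace Summit.QuantumFields.YangMills.Theorems.ColdStartUniversality

open MeasureTheory ProbabilityTheory Filter Topology
open scoped NNReal ENNReal BigOperators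
open Literature Literature.Probability.Process Literature.MathematicalPhysics.QuantumFieldTheory
open Literature.MathematicalPhysics.QuantumLattice (fundamentalRep fundamentalLatticeRep continuous_fundamentalRep)

section Flow

variable {Ω : Type} [MeasurableSpace Ω] {P : Measure Ω} [IsProbabilityMeasure P] {L : ℕ} [NeZero L]
  {W : ℝ≥0 → Ω → (Edge 3 L × NoiseIdx 2 → ℝ)}

/-- **The flow property (cocycle) of the SU(2) lattice Langevin dynamics at dyadic times**, for a jointly measurable
solution family on the canonical space. [cite: Kunita1984, Ch. II §2–3 (stochastic flows)] -/
theorem cocycle_dyadic (hW : IsFlatBrownian W P) (β : ℝ) :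
    ∃ U : GaugeConfig 3 L (Matrix.specialUnitaryGroup (Fin 2) ℂ) → ℝ≥0 →
        {p : ℝ≥0 → (Edge 3 L × NoiseIdx 2 → ℝ) // Continuous p ∧ p 0 = 0} →
        GaugeConfig 3 L (Matrix.specialUnitaryGroup (Fin 2) ℂ),
      (∀ x, (∀ p, U x 0 p = x) ∧
        (latticeLangevinDynamics (fundamentalLatticeRep 2) β).IsSolution (fundamentalRep (Fin 2))
          (isFlatBrownian_canonical hW).natFiltration
          (P.map (fun ω => (⟨fun t => W t ω, continuous_path_and_zero hW ω⟩ :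
            {p : ℝ≥0 → (Edge 3 L × NoiseIdx 2 → ℝ) // Continuous p ∧ p 0 = 0})))
          (fun (t : ℝ≥0) (p : {p : ℝ≥0 → (Edge 3 L × NoiseIdx 2 → ℝ) // Continuous p ∧ p 0 = 0}) => p.1 t) (U x)) ∧
      (∀ t, Measurable fun q : GaugeConfig 3 L (Matrix.specialUnitaryGroup (Fin 2) ℂ) ×
        {p : ℝ≥0 → (Edge 3 L × NoiseIdx 2 → ℝ) // Continuous p ∧ p 0 = 0} => U q.1 t q.2) ∧
      ∀ (x : GaugeConfig 3 L (Matrix.specialUnitaryGroup (Fin 2) ℂ)) (k₀ m₀ : ℕ) (t : ℝ≥0),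
        ∀ᵐ p ∂(P.map (fun ω => (⟨fun t => W t ω, continuous_path_and_zero hW ω⟩ :
            {p : ℝ≥0 → (Edge 3 L × NoiseIdx 2 → ℝ) // Continuous p ∧ p 0 = 0}))),
          U x ((k₀ : ℝ≥0) / 2 ^ m₀ + t) p = U (U x ((k₀ : ℝ≥0) / 2 ^ m₀) p) t
            ⟨fun v => p.1 ((k₀ : ℝ≥0) / 2 ^ m₀ + v) - p.1 ((k₀ : ℝ≥0) / 2 ^ m₀),
              continuous_shiftPath_and_zero (isFlatBrownian_canonical hW) ((k₀ : ℝ≥0) / 2 ^ m₀) p⟩ := by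
  haveI : IsProbabilityMeasure (P.map (fun ω => (⟨fun t => W t ω, continuous_path_and_zero hW ω⟩ :
      {p : ℝ≥0 → (Edge 3 L × NoiseIdx 2 → ℝ) // Continuous p ∧ p 0 = 0}))) :=
    Measure.isProbabilityMeasure_map (measurable_pathMap hW).aemeasurable
  have hWc := isFlatBrownian_canonical hW
  obtain ⟨U, G, hUG, hprog, hGm, hGc, hGae⟩ := exists_regularFlow L β hWc
  refine ⟨U, hUG, fun t => measurable_flow_pair hW U hprog t, fun x k₀ m₀ t => ?_⟩
  have hU0 : ∀ y p, U y 0 p = y := fun y p => (hUG y).1 p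
  have hX := isSolution_splice hW β U hU0 hprog hGm hGc hGae (fun y => (hUG y).2) x k₀ m₀
  have h0 : ∀ p : {p : ℝ≥0 → (Edge 3 L × NoiseIdx 2 → ℝ) // Continuous p ∧ p 0 = 0},
      (if (0 : ℝ≥0) ≤ (k₀ : ℝ≥0) / 2 ^ m₀ then U x 0 p else U (U x ((k₀ : ℝ≥0) / 2 ^ m₀) p) (0 - (k₀ : ℝ≥0) / 2 ^ m₀)
        ⟨fun v => p.1 ((k₀ : ℝ≥0) / 2 ^ m₀ + v) - p.1 ((k₀ : ℝ≥0) / 2 ^ m₀),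
          continuous_shiftPath_and_zero hWc ((k₀ : ℝ≥0) / 2 ^ m₀) p⟩) = x := fun p => by
    rw [if_pos (zero_le : (0 : ℝ≥0) ≤ _), hU0]
  have huniq := latticeLangevin_pathwise_unique hWc β x h0 (hUG x).1 hX (hUG x).2
  filter_upwards [huniq] with p hp
  have h := hp ((k₀ : ℝ≥0) / 2 ^ m₀ + t)
  rw [splice_add hW U hU0 x _ t p] at h
  exact h.symm

end Flow

section CK

variable {L : ℕ} [NeZero L]

/-- **`κ (s+t) = κ t ∘ₖ κ s` from the cocycle at `(s, t)`** (pointwise form of `chapmanKolmogorov_of_cocycle`). [folklore] -/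
theorem kernel_comp_of_cocycle_at (β' : ℝ) (s t : ℝ≥0)
    {Ω : Type} [MeasurableSpace Ω] {P : Measure Ω} [IsProbabilityMeasure P]
    {W : ℝ≥0 → Ω → (Edge 3 L × NoiseIdx 2 → ℝ)} (hW : IsFlatBrownian W P)
    (U : GaugeConfig 3 L (Matrix.specialUnitaryGroup (Fin 2) ℂ) → ℝ≥0 →
      {p : ℝ≥0 → (Edge 3 L × NoiseIdx 2 → ℝ) // Continuous p ∧ p 0 = 0} →
      GaugeConfig 3 L (Matrix.specialUnitaryGroup (Fin 2) ℂ))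
    (hU : ∀ x, (∀ p, U x 0 p = x) ∧
      (latticeLangevinDynamics (fundamentalLatticeRep 2) β').IsSolution (fundamentalRep (Fin 2))
        (isFlatBrownian_canonical hW).natFiltration
        (P.map (fun ω => (⟨fun t => W t ω, continuous_path_and_zero hW ω⟩ :
          {p : ℝ≥0 → (Edge 3 L × NoiseIdx 2 → ℝ) // Continuous p ∧ p 0 = 0})))
        (fun (t : ℝ≥0) (p : {p : ℝ≥0 → (Edge 3 L × NoiseIdx 2 → ℝ) // Continuous p ∧ p 0 = 0}) => p.1 t) (U x))
    (hmeas : ∀ t, Measurable fun q : GaugeConfig 3 L (Matrix.specialUnitaryGroup (Fin 2) ℂ) ×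
      {p : ℝ≥0 → (Edge 3 L × NoiseIdx 2 → ℝ) // Continuous p ∧ p 0 = 0} => U q.1 t q.2)
    (hcoc : ∀ (x : GaugeConfig 3 L (Matrix.specialUnitaryGroup (Fin 2) ℂ)),
      ∀ᵐ p ∂(P.map (fun ω => (⟨fun t => W t ω, continuous_path_and_zero hW ω⟩ :
          {p : ℝ≥0 → (Edge 3 L × NoiseIdx 2 → ℝ) // Continuous p ∧ p 0 = 0}))),
        U x (s + t) p = U (U x s p) t ⟨fun u => p.1 (s + u) - p.1 s,
          continuous_shiftPath_and_zero (isFlatBrownian_canonical hW) s p⟩)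
    (κ : ℝ≥0 → Kernel (GaugeConfig 3 L (Matrix.specialUnitaryGroup (Fin 2) ℂ))
      (GaugeConfig 3 L (Matrix.specialUnitaryGroup (Fin 2) ℂ))) [∀ t, IsMarkovKernel (κ t)]
    (hreal : ∀ (t : ℝ≥0) (x : GaugeConfig 3 L (Matrix.specialUnitaryGroup (Fin 2) ℂ))
        (Ω' : Type) [MeasurableSpace Ω'] (P' : Measure Ω') [IsProbabilityMeasure P']
        (W' : ℝ≥0 → Ω' → (Edge 3 L × NoiseIdx 2 → ℝ)) (hW' : IsFlatBrownian W' P')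
        (U' : ℝ≥0 → Ω' → GaugeConfig 3 L (Matrix.specialUnitaryGroup (Fin 2) ℂ)),
        (∀ ω, U' 0 ω = x) →
        (latticeLangevinDynamics (fundamentalLatticeRep 2) β').IsSolution (fundamentalRep (Fin 2))
          hW'.natFiltration P' W' U' →
        κ t x = P'.map (U' t))
    : κ (s + t) = κ t ∘ₖ κ s := by
  classical
  -- abbreviations for the canonical data
  set Pc : Measure {p : ℝ≥0 → (Edge 3 L × NoiseIdx 2 → ℝ) // Continuous p ∧ p 0 = 0} :=
    P.map (fun ω => (⟨fun t => W t ω, continuous_path_and_zero hW ω⟩ :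
      {p : ℝ≥0 → (Edge 3 L × NoiseIdx 2 → ℝ) // Continuous p ∧ p 0 = 0})) with hPc
  haveI : IsProbabilityMeasure Pc := Measure.isProbabilityMeasure_map (measurable_pathMap hW).aemeasurable
  have hWc := isFlatBrownian_canonical hW
  set θ : {p : ℝ≥0 → (Edge 3 L × NoiseIdx 2 → ℝ) // Continuous p ∧ p 0 = 0} →
      {p : ℝ≥0 → (Edge 3 L × NoiseIdx 2 → ℝ) // Continuous p ∧ p 0 = 0} :=
    fun p => ⟨fun u => p.1 (s + u) - p.1 s, continuous_shiftPath_and_zero hWc s p⟩ with hθ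
  have hθm : Measurable θ := (measurable_pi_lambda _ fun u => ((isFlatBrownian_shift hWc s).measurable u)).subtype_mk
  have hθlaw : Pc.map θ = Pc := by
    rw [hθ, map_shiftPath_eq hWc s]
    -- the path map of the coordinate process is the identity
    have hid : (fun p : {p : ℝ≥0 → (Edge 3 L × NoiseIdx 2 → ℝ) // Continuous p ∧ p 0 = 0} =>
        (⟨fun t => p.1 t, continuous_path_and_zero hWc p⟩ :
          {p : ℝ≥0 → (Edge 3 L × NoiseIdx 2 → ℝ) // Continuous p ∧ p 0 = 0})) = id := by
      funext p
      exact Subtype.ext rfl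
    rw [hid, Measure.map_id]
  have hmU : ∀ x u, Measurable (U x u) := fun x u => ((hU x).2.adapted u).mono (hWc.natFiltration.le u) le_rfl
  -- the kernels in the canonical realisation
  have hκ : ∀ u x, κ u x = Pc.map (U x u) := fun u x =>
    hreal u x _ Pc _ hWc (U x) (hU x).1 (hU x).2
  -- compare on measurable sets
  ext x A hA
  rw [Kernel.comp_apply' _ _ _ hA, hκ (s + t) x, Measure.map_apply (hmU x (s + t)) hA, hκ s x]
  -- left side: cocycle, then freezing
  have hY : Measurable[hWc.natFiltration s] (U x s) := (hU x).2.adapted s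
  have hind := indepFun_shiftPath_of_measurable hWc s hY
  set g : GaugeConfig 3 L (Matrix.specialUnitaryGroup (Fin 2) ℂ) ×
      {p : ℝ≥0 → (Edge 3 L × NoiseIdx 2 → ℝ) // Continuous p ∧ p 0 = 0} → ℝ :=
    fun q => A.indicator (fun _ => (1 : ℝ)) (U q.1 t q.2) with hg
  have hgm : Measurable g := (measurable_const.indicator hA).comp (hmeas t)
  have hgb : ∀ q, |g q| ≤ 1 := fun q => by
    simp only [hg]
    by_cases h : U q.1 t q.2 ∈ A <;> simp [h]
  have hfreeze := IsBrownianVec.integral_comp_eq_integral_integral_of_indepFun (hmU x s) hθm hind hgm hgb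
  rw [hθlaw] at hfreeze
  -- `Pc (U x (s+t) ⁻¹' A)` as an integral of `g (U x s p, θ p)`
  have hL : (Pc (U x (s + t) ⁻¹' A)).toReal = ∫ p, g (U x s p, θ p) ∂Pc := by
    have hset : Pc (U x (s + t) ⁻¹' A) = Pc ((fun p => U (U x s p) t (θ p)) ⁻¹' A) :=
      measure_congr ((hcoc x).mono fun p hp => by
        show (U x (s + t) p ∈ A) = (U (U x s p) t (θ p) ∈ A)
        exact congrArg (· ∈ A) hp)
    have hm2 : Measurable fun p => U (U x s p) t (θ p) := by
      have h := (hmeas t).comp ((hmU x s).prodMk hθm)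
      exact h
    rw [hset, ← measureReal_def, ← mul_one (Pc.real _), ← smul_eq_mul, ← setIntegral_const,
      ← integral_indicator (hm2 hA)]
    rfl
  -- the inner integral is the kernel `κ t` at the frozen start
  have hR : ∀ y, ∫ e, g (y, e) ∂Pc = (κ t y A).toReal := by
    intro y
    rw [hκ t y, Measure.map_apply (hmU y t) hA, ← measureReal_def, ← mul_one (Pc.real _), ← smul_eq_mul,
      ← setIntegral_const, ← integral_indicator (hmU y t hA)]
    rfl
  simp_rw [hR] at hfreeze
  -- assemble
  have hfin : ∫⁻ y, κ t y A ∂(Pc.map (U x s)) ≠ ∞ := by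
    refine ne_top_of_le_ne_top (measure_ne_top (Pc.map (U x s)) Set.univ) ?_
    calc ∫⁻ y, κ t y A ∂(Pc.map (U x s)) ≤ ∫⁻ _y, 1 ∂(Pc.map (U x s)) := lintegral_mono fun y => prob_le_one
      _ = _ := by rw [lintegral_const, one_mul]
  refine (ENNReal.toReal_eq_toReal_iff' (measure_ne_top _ _) hfin).1 ?_
  rw [hL, hfreeze, ← integral_toReal ((κ t).measurable_coe hA).aemeasurable
    (Eventually.of_forall fun y => measure_lt_top (κ t y) A),
    integral_map (hmU x s).aemeasurable]
  exact ((κ t).measurable_coe hA).ennreal_toReal.aestronglyMeasurable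


/-- **Chapman–Kolmogorov at dyadic first times.** [folklore] -/
theorem chapmanKolmogorov_dyadic (β' : ℝ)
    (κ : ℝ≥0 → Kernel (GaugeConfig 3 L (Matrix.specialUnitaryGroup (Fin 2) ℂ))
      (GaugeConfig 3 L (Matrix.specialUnitaryGroup (Fin 2) ℂ))) [∀ t, IsMarkovKernel (κ t)]
    (hreal : (∀ (t : ℝ≥0) (x : GaugeConfig 3 L (Matrix.specialUnitaryGroup (Fin 2) ℂ))
        (Ω' : Type) [MeasurableSpace Ω'] (P' : Measure Ω') [IsProbabilityMeasure P']
        (W' : ℝ≥0 → Ω' → (Edge 3 L × NoiseIdx 2 → ℝ)) (hW' : IsFlatBrownian W' P')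
        (U' : ℝ≥0 → Ω' → GaugeConfig 3 L (Matrix.specialUnitaryGroup (Fin 2) ℂ)),
        (∀ ω, U' 0 ω = x) →
        (latticeLangevinDynamics (fundamentalLatticeRep 2) β').IsSolution (fundamentalRep (Fin 2))
          hW'.natFiltration P' W' U' →
        κ t x = P'.map (U' t)))
    (k₀ m₀ : ℕ) (t : ℝ≥0) : κ ((k₀ : ℝ≥0) / 2 ^ m₀ + t) = κ t ∘ₖ κ ((k₀ : ℝ≥0) / 2 ^ m₀) := by
  haveI := isProbabilityMeasure_piWiener (Edge 3 L × NoiseIdx 2)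
  have hWpi := isFlatBrownian_piWiener 3 L (NoiseIdx 2)
  obtain ⟨U, hU, hm, hc⟩ := cocycle_dyadic hWpi β'
  exact kernel_comp_of_cocycle_at β' _ t hWpi U hU hm (fun x => hc x k₀ m₀ t) κ hreal

/-- **Chapman–Kolmogorov for THE transition kernels of the SU(2) lattice Langevin dynamics** (all times). [folklore] -/
theorem chapmanKolmogorov_szz (β' : ℝ)
    (κ : ℝ≥0 → Kernel (GaugeConfig 3 L (Matrix.specialUnitaryGroup (Fin 2) ℂ))
      (GaugeConfig 3 L (Matrix.specialUnitaryGroup (Fin 2) ℂ))) [∀ t, IsMarkovKernel (κ t)]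
    (hreal : (∀ (t : ℝ≥0) (x : GaugeConfig 3 L (Matrix.specialUnitaryGroup (Fin 2) ℂ))
        (Ω' : Type) [MeasurableSpace Ω'] (P' : Measure Ω') [IsProbabilityMeasure P']
        (W' : ℝ≥0 → Ω' → (Edge 3 L × NoiseIdx 2 → ℝ)) (hW' : IsFlatBrownian W' P')
        (U' : ℝ≥0 → Ω' → GaugeConfig 3 L (Matrix.specialUnitaryGroup (Fin 2) ℂ)),
        (∀ ω, U' 0 ω = x) →
        (latticeLangevinDynamics (fundamentalLatticeRep 2) β').IsSolution (fundamentalRep (Fin 2))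
          hW'.natFiltration P' W' U' →
        κ t x = P'.map (U' t)))
    (s t : ℝ≥0) : κ (s + t) = κ t ∘ₖ κ s := by
  classical
  haveI := secondCountableTopology_su2
  haveI := borelSpace_config L
  haveI := polishSpace_config L
  haveI := isProbabilityMeasure_piWiener (Edge 3 L × NoiseIdx 2)
  have hWpi := isFlatBrownian_piWiener 3 L (NoiseIdx 2)
  -- a solution family with continuous paths on the canonical space, realising the kernels
  obtain ⟨U, hU, -, -⟩ := cocycle_dyadic hWpi β'
  set Pc := (Measure.pi fun _ : Edge 3 L × NoiseIdx 2 => preWienerMeasure).map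
    (fun ω => (⟨fun t => (fun i : Edge 3 L × NoiseIdx 2 => brownian t (ω i)),
      continuous_path_and_zero hWpi ω⟩ : {p : ℝ≥0 → (Edge 3 L × NoiseIdx 2 → ℝ) // Continuous p ∧ p 0 = 0})) with hPc
  haveI : IsProbabilityMeasure Pc := Measure.isProbabilityMeasure_map (measurable_pathMap hWpi).aemeasurable
  have hWc := isFlatBrownian_canonical hWpi
  have hκ : ∀ u x, κ u x = Pc.map (U x u) := fun u x => hreal u x _ Pc _ hWc (U x) (hU x).1 (hU x).2
  have hmU : ∀ x u, Measurable (U x u) := fun x u => ((hU x).2.adapted u).mono (hWc.natFiltration.le u) le_rfl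
  -- Feller
  have hFeller : ∀ (f : BoundedContinuousFunction (GaugeConfig 3 L (Matrix.specialUnitaryGroup (Fin 2) ℂ)) ℝ),
      Continuous fun y => ∫ z, f z ∂(κ t y) := fun f =>
    continuous_integral_transitionKernel L β' κ hreal t f.continuous
  ext x : 1
  refine ext_of_forall_integral_eq_of_IsFiniteMeasure fun f => ?_
  -- dyadic approximation of `s` from below
  have hlim := tendsto_sampleLeft s
  have hdy : ∀ m : ℕ, κ (sampleLeft m s + t) = κ t ∘ₖ κ (sampleLeft m s) := fun m =>
    chapmanKolmogorov_dyadic β' κ hreal (⌈(s : ℝ) * 2 ^ m⌉₊ - 1) m t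
  obtain ⟨C, hC⟩ : ∃ C, ∀ z, |f z| ≤ C := ⟨‖f‖, fun z => by
    simpa [Real.norm_eq_abs] using f.norm_coe_le_norm z⟩
  -- left side along the approximation
  have hL : Tendsto (fun m => ∫ z, f z ∂(κ (sampleLeft m s + t) x)) atTop (𝓝 (∫ z, f z ∂(κ (s + t) x))) := by
    simp_rw [hκ _ x, integral_map (hmU x _).aemeasurable f.continuous.aestronglyMeasurable]
    refine tendsto_integral_of_dominated_convergence (fun _ => C) (fun m =>
      (f.continuous.measurable.comp (hmU x _)).aestronglyMeasurable) (integrable_const C)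
      (fun m => Eventually.of_forall fun p => by simpa [Real.norm_eq_abs] using hC _) ?_
    filter_upwards [(hU x).2.continuous] with p hp
    exact (f.continuous.tendsto _).comp ((hp.tendsto _).comp (hlim.add tendsto_const_nhds))
  -- right side along the approximation
  have hg : ∀ μ : Measure (GaugeConfig 3 L (Matrix.specialUnitaryGroup (Fin 2) ℂ)), IsProbabilityMeasure μ →
      ∫ z, f z ∂(μ.bind (κ t)) = ∫ y, (∫ z, f z ∂(κ t y)) ∂μ := by
    intro μ hμ
    have hint : Integrable f (μ.bind (κ t)) := by
      haveI : IsProbabilityMeasure (μ.bind (κ t)) := by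
        constructor
        rw [Measure.bind_apply MeasurableSet.univ (κ t).measurable.aemeasurable]
        simp
      exact (integrable_const C).mono' f.continuous.measurable.aestronglyMeasurable
        (Eventually.of_forall fun z => by simpa [Real.norm_eq_abs] using hC z)
    exact Literature.Probability.Process.Harris.integral_comp_measure (κ t) μ hint
  have hR : Tendsto (fun m => ∫ z, f z ∂((κ t ∘ₖ κ (sampleLeft m s)) x)) atTop
      (𝓝 (∫ z, f z ∂((κ t ∘ₖ κ s) x))) := by
    have heq : ∀ u, ∫ z, f z ∂((κ t ∘ₖ κ u) x) = ∫ p, (fun y => ∫ z, f z ∂(κ t y)) (U x u p) ∂Pc := by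
      intro u
      rw [Kernel.comp_apply, hg _ inferInstance, hκ u x,
        integral_map (hmU x u).aemeasurable (hFeller f).aestronglyMeasurable]
    simp_rw [heq]
    have hgC : ∀ y, |∫ z, f z ∂(κ t y)| ≤ C := fun y => by
      have h1 : |∫ z, f z ∂(κ t y)| ≤ ∫ z, |f z| ∂(κ t y) := abs_integral_le_integral_abs
      have h2 : ∫ z, |f z| ∂(κ t y) ≤ ∫ _z, C ∂(κ t y) :=
        integral_mono (((integrable_const C).mono' f.continuous.measurable.aestronglyMeasurable
          (Eventually.of_forall fun z => by simpa [Real.norm_eq_abs] using hC z)).abs) (integrable_const C)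
          fun z => hC z
      rw [integral_const, probReal_univ, one_smul] at h2
      exact h1.trans h2
    refine tendsto_integral_of_dominated_convergence (fun _ => C) (fun m =>
      ((hFeller f).measurable.comp (hmU x _)).aestronglyMeasurable) (integrable_const C)
      (fun m => Eventually.of_forall fun p => by simpa [Real.norm_eq_abs] using hgC _) ?_
    filter_upwards [(hU x).2.continuous] with p hp
    exact ((hFeller f).tendsto _).comp ((hp.tendsto _).comp hlim)
  have hLR : (fun m => ∫ z, f z ∂(κ (sampleLeft m s + t) x)) = fun m => ∫ z, f z ∂((κ t ∘ₖ κ (sampleLeft m s)) x) := by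
    funext m
    rw [hdy m]
  rw [hLR] at hL
  exact tendsto_nhds_unique hL hR

end CK

/-- ★ **The rung `stub_fixedCutoffMixing` of K_A1 from (D) a Doeblin minorisation of THE SZZ transition kernels and the
named fact `WilsonMeasureLangevinInvariant` (SZZ Lemma 3.3)** — Chapman–Kolmogorov (`chapmanKolmogorov_szz`, from the
flow property proved in this tree) and Harris' theorem (`fixedCutoffMixing_of_harris`). [cite: HairerMattingly2011, Theorems 1.2 and 1.3] [cite: ShenZhuZhu2022, §3 Lemma 3.3 (p. 13)] -/
theorem fixedCutoffMixing_of_doeblin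
    (hD : ∀ (L : ℕ) [NeZero L] (β' : ℝ)
      (κ : ℝ≥0 → Kernel (GaugeConfig 3 L (Matrix.specialUnitaryGroup (Fin 2) ℂ))
        (GaugeConfig 3 L (Matrix.specialUnitaryGroup (Fin 2) ℂ))) [∀ t, IsMarkovKernel (κ t)],
      (∀ (t : ℝ≥0) (x : GaugeConfig 3 L (Matrix.specialUnitaryGroup (Fin 2) ℂ))
          (Ω : Type) [MeasurableSpace Ω] (P : Measure Ω) [IsProbabilityMeasure P]
          (W : ℝ≥0 → Ω → (Edge 3 L × NoiseIdx 2 → ℝ)) (hW : IsFlatBrownian W P)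
          (U : ℝ≥0 → Ω → GaugeConfig 3 L (Matrix.specialUnitaryGroup (Fin 2) ℂ)),
          (∀ ω, U 0 ω = x) →
          (latticeLangevinDynamics (fundamentalLatticeRep 2) β').IsSolution (fundamentalRep (Fin 2))
            hW.natFiltration P W U →
          κ t x = P.map (U t)) →
      ∃ (t₀ : ℝ≥0) (ν : Measure (GaugeConfig 3 L (Matrix.specialUnitaryGroup (Fin 2) ℂ))),
        ν ≠ 0 ∧ ∀ z, ν ≤ κ t₀ z)
    (hWinv : ∀ (L : ℕ) [NeZero L] (β' : ℝ), WilsonMeasureLangevinInvariant (fundamentalLatticeRep 2) 3 L β') :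
    ∀ (F : Balaban1983to89.T3ContinuumYM3Torus.T3Family) (γ : ℝ), 0 < γ →
      ∀ (os : List (Balaban1983to89.T3ContinuumYM3Torus.ULoop3 F)) (δ : ℝ), 0 < δ → ∀ K : ℕ, ∃ T : ℝ, 0 < T ∧
        ∀ (Ω : Type) (mΩ : MeasurableSpace Ω) (P : Measure Ω) (hP : IsProbabilityMeasure P)
          (W : ℝ≥0 → Ω → (Edge 3 ((F.P K).sitesPerDir 0) × NoiseIdx 2 → ℝ)) (hW : IsFlatBrownian W P)
          (U : ℝ≥0 → Ω → GaugeConfig 3 ((F.P K).sitesPerDir 0) (Matrix.specialUnitaryGroup (Fin 2) ℂ)),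
          (∀ ω, U 0 ω = fun _ => 1) →
          (latticeLangevinDynamics (fundamentalLatticeRep 2) ((γ * (F.P K).eps)⁻¹ / 2)).IsSolution
            (fundamentalRep (Fin 2)) hW.natFiltration P W U →
          |(F.scheme (Balaban1983to89.ExpMeanLog.expMeanLogSU :
                Balaban1983to89.LoopAverage (Matrix.specialUnitaryGroup (Fin 2) ℂ)) γ).expectAt K os -
              T⁻¹ * ∫ s in (0 : ℝ)..T, (∫ ω, (os.map fun C => F.avgObs (Balaban1983to89.ExpMeanLog.expMeanLogSU :
                  Balaban1983to89.LoopAverage (Matrix.specialUnitaryGroup (Fin 2) ℂ)) K C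
                (fun b : Balaban1983to89.PBond (F.P K) 0 => U (s / (F.P K).eps).toNNReal ω (b.src, b.dir))).prod ∂P)| ≤ δ :=
  fixedCutoffMixing_of_harris (fun _ _ β' κ _ hreal => chapmanKolmogorov_szz β' κ hreal) hD hWinv

end Summit.QuantumFields.YangMills.Theorems.ColdStartUniversality

end
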